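import Summits.ValiantsHypothesis.ValiantsHypothesis.Theses.DivisionGap

/-!
# The charged/uncharged split of `ZeroOneTransfer` (crux `stmt-ValiantsHypothesis-5066`, H2 of route DivisionGap)

Support file for crux `stmt-ValiantsHypothesis-5066` (`ZeroOneTransfer`), line `charged-uncharged`
(wall-breaker strategist p1, 2026-08-17; landed by line lead c8).  It is the GLUE of the line: the
crux is the exact conjunction of two strictly weaker statements, split along the COST OF THE
COFACTOR `h` in the Hrubeš–Yehudayoff normal form `f · h = g`:

* **MonotoneMultiples** (MM, uncharged transfer): every 0/1-coefficient family over `ℝ≥0` whose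
  complexification is in `VP_ℂ` has, for some `c` and all `n`, SOME nonzero nonnegative multiple
  `f_n · h` of monotone complexity `≤ 2 ^ ((log₂ n + c) ^ c)` — the cofactor `h` is not paid for;
* **CofactorCharging** (CC): for such a family there is `k` such that every nonzero cofactor `h`
  can be traded for a nonzero `h'` with
  `L₊(f_n h') + L₊(h') ≤ 2 ^ ((log₂ n + log₂ L₊(f_n h) + k) ^ k)`.

Kernel-checked here (statements inline, so that the theorems are definitionally the glue
`MonotoneMultiples → CofactorCharging → ZeroOneTransfer` of a route split with these two children):
`zeroOneTransfer_of_split` (modus ponens + quasi-polynomial absorption `Split.qp_absorb`), the two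
converses `monotoneMultiples_of_zeroOneTransfer` (drop the charge) and
`cofactorCharging_of_zeroOneTransfer` (the crux's certificate serves for every `h`), and
`zeroOneTransfer_iff_split : ZeroOneTransfer ↔ MM ∧ CC`.  So neither child is the crux in a normal
form, and a refutation of either child refutes the crux.

Not here: any claim about MM or CC themselves (both are open; see the line card
`Cruxes/ZeroOneTransfer/Lines/charged-uncharged.md` and `STRATEGY-CENSUS.md`).
-/

noncomputable section

-- Sub = Summit single-conjunct layout: the duplicated namespace component is mandated by the tree.
set_option linter.dupNamespace false

namespace Summit.ValiantsHypothesis.ValiantsHypothesis.Theorems.DivisionGapZeroOneTransfer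

open Literature.Computability.AlgebraicComplexity
open Summit.ValiantsHypothesis.ValiantsHypothesis.Theses.DivisionGap
open MvPolynomial
open scoped NNReal

namespace Split

/-- Arithmetic: `a + (a + c) ^ c + k ≤ (a + c + k + 1) ^ (c + 1)` for all naturals. [folklore] -/
theorem base_absorb (a c k : ℕ) : a + (a + c) ^ c + k ≤ (a + c + k + 1) ^ (c + 1) := by
  rcases Nat.eq_zero_or_pos c with rfl | hc
  · simp; omega
  set b := a + c + k + 1 with hb
  have hb2 : 2 ≤ b := by omega
  have h1 : a + k ≤ b := by omega
  have h2 : (a + c) ^ c ≤ b ^ c := Nat.pow_le_pow_left (by omega) c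
  have hbc : b ≤ b ^ c := by
    calc b = b ^ 1 := (pow_one b).symm
      _ ≤ b ^ c := Nat.pow_le_pow_right (by omega) hc
  calc a + (a + c) ^ c + k = (a + k) + (a + c) ^ c := by ring
    _ ≤ b + b ^ c := Nat.add_le_add h1 h2
    _ ≤ b ^ c + b ^ c := Nat.add_le_add_right hbc _
    _ = 2 * b ^ c := by ring
    _ ≤ b * b ^ c := Nat.mul_le_mul_right _ hb2
    _ = b ^ (c + 1) := by ring

/-- **Quasi-polynomial absorption.** For all `c k` there is `C` with
`(a + (a + c) ^ c + k) ^ k ≤ (a + C) ^ C` for every `a`: composing two quasi-polynomial bounds is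
quasi-polynomial. [folklore] -/
theorem qp_absorb (c k : ℕ) : ∃ C : ℕ, ∀ a : ℕ, (a + (a + c) ^ c + k) ^ k ≤ (a + C) ^ C := by
  refine ⟨(c + 1) * (k + 1) + 1, fun a => ?_⟩
  set C := (c + 1) * (k + 1) + 1 with hC
  have hCk : (c + 1) * k ≤ C := by rw [hC]; nlinarith
  have h1 : (a + (a + c) ^ c + k) ^ k ≤ ((a + c + k + 1) ^ (c + 1)) ^ k :=
    Nat.pow_le_pow_left (base_absorb a c k) k
  have h2 : ((a + c + k + 1) ^ (c + 1)) ^ k = (a + c + k + 1) ^ ((c + 1) * k) := by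
    rw [← pow_mul]
  have h3 : (a + c + k + 1) ^ ((c + 1) * k) ≤ (a + C) ^ ((c + 1) * k) :=
    Nat.pow_le_pow_left (by rw [hC]; nlinarith) _
  have h4 : (a + C) ^ ((c + 1) * k) ≤ (a + C) ^ C :=
    Nat.pow_le_pow_right (by omega) hCk
  calc (a + (a + c) ^ c + k) ^ k ≤ ((a + c + k + 1) ^ (c + 1)) ^ k := h1
    _ = (a + c + k + 1) ^ ((c + 1) * k) := h2
    _ ≤ (a + C) ^ ((c + 1) * k) := h3
    _ ≤ (a + C) ^ C := h4

end Split

/-- **The glue of line `charged-uncharged`: `MonotoneMultiples → CofactorCharging → ZeroOneTransfer`.**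
If every 0/1-coefficient family over `ℝ≥0` with complexification in `VP_ℂ` has a nonzero
nonnegative multiple `f_n · h` of quasi-polynomial monotone complexity (first hypothesis, MM:
the cofactor is NOT charged), and every nonzero cofactor `h` of such a family can be CHARGED —
replaced by a nonzero `h'` with `L₊(f_n h') + L₊(h')` quasi-polynomial in `n` and `L₊(f_n h)`
(second hypothesis, CC) — then `ZeroOneTransfer` holds.  Proof: modus ponens and
`Split.qp_absorb`.  Both hypotheses are stated inline (they are the two children of the intended
route split; this theorem is definitionally its glue). [folklore] -/
theorem zeroOneTransfer_of_split :
    (∀ (σ : ℕ → Type) [∀ n, Fintype (σ n)] (f : ∀ n, MvPolynomial (σ n) NNReal),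
      (∀ n m, MvPolynomial.coeff m (f n) = 0 ∨ MvPolynomial.coeff m (f n) = 1) →
      Literature.Computability.AlgebraicComplexity.IsVPFamily (k := ℂ)
        (fun n => MvPolynomial.map (Complex.ofRealHom.comp NNReal.toRealHom) (f n)) →
      ∃ c : ℕ, ∀ n, ∃ h : MvPolynomial (σ n) NNReal, h ≠ 0 ∧
        Literature.Computability.AlgebraicComplexity.complexity (f n * h) ≤
          2 ^ ((Nat.log 2 n + c) ^ c)) →
    (∀ (σ : ℕ → Type) [∀ n, Fintype (σ n)] (f : ∀ n, MvPolynomial (σ n) NNReal),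
      (∀ n m, MvPolynomial.coeff m (f n) = 0 ∨ MvPolynomial.coeff m (f n) = 1) →
      Literature.Computability.AlgebraicComplexity.IsVPFamily (k := ℂ)
        (fun n => MvPolynomial.map (Complex.ofRealHom.comp NNReal.toRealHom) (f n)) →
      ∃ k : ℕ, ∀ n, ∀ h : MvPolynomial (σ n) NNReal, h ≠ 0 →
        ∃ h' : MvPolynomial (σ n) NNReal, h' ≠ 0 ∧
          Literature.Computability.AlgebraicComplexity.complexity (f n * h') +
              Literature.Computability.AlgebraicComplexity.complexity h' ≤
            2 ^ ((Nat.log 2 n + Nat.log 2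
              (Literature.Computability.AlgebraicComplexity.complexity (f n * h)) + k) ^ k)) →
    Summit.ValiantsHypothesis.ValiantsHypothesis.Theses.DivisionGap.ZeroOneTransfer := by
  intro hMM hCC σ _ f h01 hVP
  obtain ⟨c, hc⟩ := hMM σ f h01 hVP
  obtain ⟨k, hk⟩ := hCC σ f h01 hVP
  obtain ⟨C, hC⟩ := Split.qp_absorb c k
  refine ⟨C, fun n => ?_⟩
  obtain ⟨h, hne, hle⟩ := hc n
  obtain ⟨h', hne', hle'⟩ := hk n h hne
  refine ⟨h', hne', hle'.trans ?_⟩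
  have hlog : Nat.log 2 (complexity (f n * h)) ≤ (Nat.log 2 n + c) ^ c := by
    have := Nat.log_mono_right (b := 2) hle
    rwa [Nat.log_pow Nat.one_lt_two] at this
  calc 2 ^ ((Nat.log 2 n + Nat.log 2 (complexity (f n * h)) + k) ^ k)
      ≤ 2 ^ ((Nat.log 2 n + (Nat.log 2 n + c) ^ c + k) ^ k) := by
        apply Nat.pow_le_pow_right Nat.two_pos
        exact Nat.pow_le_pow_left (by omega) k
    _ ≤ 2 ^ ((Nat.log 2 n + C) ^ C) := Nat.pow_le_pow_right Nat.two_pos (hC _)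

/-- **Converse (i): `ZeroOneTransfer → MonotoneMultiples`.**  The crux implies the uncharged
transfer: drop the charge `L₊(h)` from the crux's certificate. [folklore] -/
theorem monotoneMultiples_of_zeroOneTransfer
    (H : Summit.ValiantsHypothesis.ValiantsHypothesis.Theses.DivisionGap.ZeroOneTransfer) :
    ∀ (σ : ℕ → Type) [∀ n, Fintype (σ n)] (f : ∀ n, MvPolynomial (σ n) NNReal),
      (∀ n m, MvPolynomial.coeff m (f n) = 0 ∨ MvPolynomial.coeff m (f n) = 1) →
      Literature.Computability.AlgebraicComplexity.IsVPFamily (k := ℂ)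
        (fun n => MvPolynomial.map (Complex.ofRealHom.comp NNReal.toRealHom) (f n)) →
      ∃ c : ℕ, ∀ n, ∃ h : MvPolynomial (σ n) NNReal, h ≠ 0 ∧
        Literature.Computability.AlgebraicComplexity.complexity (f n * h) ≤
          2 ^ ((Nat.log 2 n + c) ^ c) := by
  intro σ _ f h01 hVP
  obtain ⟨c, hc⟩ := H σ f h01 hVP
  refine ⟨c, fun n => ?_⟩
  obtain ⟨h, hne, hle⟩ := hc n
  exact ⟨h, hne, (Nat.le_add_right _ _).trans hle⟩

/-- **Converse (ii): `ZeroOneTransfer → CofactorCharging`.**  The crux implies cofactor charging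
for 0/1 `VP_ℂ` families: the crux's own certificate `h'` serves for every `h`, since
`2 ^ ((log₂ n + c) ^ c) ≤ 2 ^ ((log₂ n + log₂ L + c) ^ c)`. [folklore] -/
theorem cofactorCharging_of_zeroOneTransfer
    (H : Summit.ValiantsHypothesis.ValiantsHypothesis.Theses.DivisionGap.ZeroOneTransfer) :
    ∀ (σ : ℕ → Type) [∀ n, Fintype (σ n)] (f : ∀ n, MvPolynomial (σ n) NNReal),
      (∀ n m, MvPolynomial.coeff m (f n) = 0 ∨ MvPolynomial.coeff m (f n) = 1) →
      Literature.Computability.AlgebraicComplexity.IsVPFamily (k := ℂ)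
        (fun n => MvPolynomial.map (Complex.ofRealHom.comp NNReal.toRealHom) (f n)) →
      ∃ k : ℕ, ∀ n, ∀ h : MvPolynomial (σ n) NNReal, h ≠ 0 →
        ∃ h' : MvPolynomial (σ n) NNReal, h' ≠ 0 ∧
          Literature.Computability.AlgebraicComplexity.complexity (f n * h') +
              Literature.Computability.AlgebraicComplexity.complexity h' ≤
            2 ^ ((Nat.log 2 n + Nat.log 2
              (Literature.Computability.AlgebraicComplexity.complexity (f n * h)) + k) ^ k) := by
  intro σ _ f h01 hVP
  obtain ⟨c, hc⟩ := H σ f h01 hVP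
  refine ⟨c, fun n h _ => ?_⟩
  obtain ⟨h', hne', hle'⟩ := hc n
  refine ⟨h', hne', hle'.trans ?_⟩
  apply Nat.pow_le_pow_right Nat.two_pos
  exact Nat.pow_le_pow_left (by omega) c

/-- **The split is exact: `ZeroOneTransfer ↔ MonotoneMultiples ∧ CofactorCharging`** (both children
stated inline).  Hence neither child is the crux in a normal form (each is implied by the crux,
neither alone is known to imply it), and a refutation of either child refutes the crux. [folklore] -/
theorem zeroOneTransfer_iff_split :
    Summit.ValiantsHypothesis.ValiantsHypothesis.Theses.DivisionGap.ZeroOneTransfer ↔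
      ((∀ (σ : ℕ → Type) [∀ n, Fintype (σ n)] (f : ∀ n, MvPolynomial (σ n) NNReal),
        (∀ n m, MvPolynomial.coeff m (f n) = 0 ∨ MvPolynomial.coeff m (f n) = 1) →
        Literature.Computability.AlgebraicComplexity.IsVPFamily (k := ℂ)
          (fun n => MvPolynomial.map (Complex.ofRealHom.comp NNReal.toRealHom) (f n)) →
        ∃ c : ℕ, ∀ n, ∃ h : MvPolynomial (σ n) NNReal, h ≠ 0 ∧
          Literature.Computability.AlgebraicComplexity.complexity (f n * h) ≤
            2 ^ ((Nat.log 2 n + c) ^ c)) ∧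
      (∀ (σ : ℕ → Type) [∀ n, Fintype (σ n)] (f : ∀ n, MvPolynomial (σ n) NNReal),
        (∀ n m, MvPolynomial.coeff m (f n) = 0 ∨ MvPolynomial.coeff m (f n) = 1) →
        Literature.Computability.AlgebraicComplexity.IsVPFamily (k := ℂ)
          (fun n => MvPolynomial.map (Complex.ofRealHom.comp NNReal.toRealHom) (f n)) →
        ∃ k : ℕ, ∀ n, ∀ h : MvPolynomial (σ n) NNReal, h ≠ 0 →
          ∃ h' : MvPolynomial (σ n) NNReal, h' ≠ 0 ∧
            Literature.Computability.AlgebraicComplexity.complexity (f n * h') +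
                Literature.Computability.AlgebraicComplexity.complexity h' ≤
              2 ^ ((Nat.log 2 n + Nat.log 2
                (Literature.Computability.AlgebraicComplexity.complexity (f n * h)) + k) ^ k))) :=
  ⟨fun H => ⟨monotoneMultiples_of_zeroOneTransfer H, cofactorCharging_of_zeroOneTransfer H⟩,
    fun H => zeroOneTransfer_of_split H.1 H.2⟩

end Summit.ValiantsHypothesis.ValiantsHypothesis.Theorems.DivisionGapZeroOneTransfer
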